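import Summits.BirchSwinnertonDyer.BirchSwinnertonDyer.Theorems.AlignedTransportAtTwoMainConjectureTransportAlignedAtTwoAlignedAtTwoCongruence
import Summits.BirchSwinnertonDyer.BirchSwinnertonDyer.Theorems.AlignedTransportAtTwoMainConjectureTransportAlignedAtTwoRungCell6213a
import Summits.BirchSwinnertonDyer.BirchSwinnertonDyer.Theorems.AlignedTransportAtTwoCertifiedSeedsRowsB
import Summits.BirchSwinnertonDyer.BirchSwinnertonDyer.Theorems.AlignedTransportAtTwoMainConjectureTransportAlignedAtTwoAlignedAtInfinityNegDisc
import Summits.BirchSwinnertonDyer.BirchSwinnertonDyer.Theorems.AlignedTransportAtTwoMainConjectureTransportAlignedAtTwoTwistKidaCellM1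
import HarnessLib

/-!
# Route `AlignedTransportAtTwo`, (γ) rows of crux C2 `MainConjectureOfRankZeroBSDAtTwo` (stmt-BirchSwinnertonDyer-22298):
# the two cell′ SEED binders not in the tower-class files — `Δ′ < 0` (hence `Δ′ ∉ ℚ²`) and `¬ HasCM` (`j ∉ ℤ`) — for the eleven
# certified thin-cell′ seeds other than `2071a1`

WIDTH-5 attach seat `bsd-line-att-p3` g24 (cell `bsd-f1-sign2`); `--supports stmt-BirchSwinnertonDyer-22298 --as helper`.
THEOREMS ONLY — no `def`, no named fact, no `sorry`. BSD is NOT proved; no crux is closed.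

WHY. The cell predicates `AlignedTransportAtTwoRungDefs.AlignedSeedCellAtTwo` / `CertifiedAlignedSeedCellAtTwo` (the `by_cases`
predicate of the route's `closes` / of the (γ) re-glue `closes_certified`) ask of the SEED `W′`: `¬ W′.HasCM` and `Δ(W′) ∉ ℚ²`,
besides the binders kernel-decided in `Theorems/ByReductionTypeAtTwoTowerClass<seed>.lean` (good ordinary at `2`, no rational
`2`-torsion abscissa). `AlignedTransportAtTwoRungCell` supplied them for `2071a1`; this file supplies them for the other eleven
certified seeds of D-imc-12 (`1727a1, 4087c1, 4087a1, 7831a1, 9557a1, 12261b1, 19653d1, 25861b1, 25861e1, 8035a1, 24213c1`),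
plus `Δ′ < 0` itself (the input of `alignedAtInfinity_of_Δ_neg` in the sequel pair files `…AlignedPairT<target>`): `Δ′ < 0` from the
model (`M<seed>_Δ`), `¬ CM` because `gcd(Δ′, c₄′) = 1` forces `Δ′ ∤ c₄′³`, i.e. `j ∉ ℤ` (tree
`OrdRedAtTwo.not_hasCM_baseChange_int_of_not_dvd_c₄_pow`, Silverman ATAEC II.6.1).

References: [CremonaAlgorithms1997] Table 1; [SilvermanATAEC1994] Thm. II.6.1; [SilvermanAEC2009] App. C §11.
-/

set_option autoImplicit false
-- `….BirchSwinnertonDyer.BirchSwinnertonDyer.…` is the summit/sub-problem namespace (D-0017): dupNamespace is intended.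
set_option linter.dupNamespace false

noncomputable section

open scoped Classical MatrixGroups ModularForm

open NumberField IsDedekindDomain CongruenceSubgroup WeierstrassCurve Polynomial
open Literature.NumberTheory.EllipticCurves Literature.NumberTheory.EllipticCurves.ModularForms
open Literature.NumberTheory.EllipticCurves.Rank1Residual Literature.NumberTheory.EllipticCurves.Rank1Residual.Typed
open Literature.NumberTheory.EllipticCurves.Greenberg1999
open Summit.BirchSwinnertonDyer.Rank1Residual Summit.BirchSwinnertonDyer.Rank1Residual.F1Sign2
open Summit.BirchSwinnertonDyer.Rank1Residual.X1.MuLambda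
open Summit.BirchSwinnertonDyer.Rank1Residual.X5 Summit.BirchSwinnertonDyer.Rank1Residual.X5.O1
open Summit.BirchSwinnertonDyer.Rank1Residual.X5.Instances
open Summit.BirchSwinnertonDyer.BirchSwinnertonDyer.Theorems.KatoHalfPinch
open Summit.BirchSwinnertonDyer.BirchSwinnertonDyer.Theorems.Rank1ResidualX1Defs
open Summit.BirchSwinnertonDyer.BirchSwinnertonDyer.Theses.AlignedTransportAtTwo
open Summit.BirchSwinnertonDyer.BirchSwinnertonDyer.Theorems.TowerClass
open Summit.BirchSwinnertonDyer.BirchSwinnertonDyer.Theorems.AlignedTransportAtTwoRungCell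
open Summit.BirchSwinnertonDyer.BirchSwinnertonDyer.Theorems.AlignedTransportAtTwoRungDefs
open Summit.BirchSwinnertonDyer.BirchSwinnertonDyer.Theorems.AlignedTransportAtTwoRungSplit
open Summit.BirchSwinnertonDyer.BirchSwinnertonDyer.Theorems.AlignedTransportAtTwoCertifiedSeeds
open Summit.BirchSwinnertonDyer.BirchSwinnertonDyer.Theorems.AlignedTransportAtTwoSharedCubicTorsion
open Summit.BirchSwinnertonDyer.BirchSwinnertonDyer.Theorems.AlignedTransportAtTwoAlignedAtInfinityNegDisc
open Summit.BirchSwinnertonDyer.BirchSwinnertonDyer.Theorems.AlignedTransportAtTwoAlignedAtTwoCongruence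
open Summit.BirchSwinnertonDyer.BirchSwinnertonDyer.Theorems.AlignedTransportAtTwoTwistKidaCellM1

namespace Summit.BirchSwinnertonDyer.BirchSwinnertonDyer.Theorems.AlignedTransportAtTwoAlignedPairs

/-! ### Seed `1727a1` -/

/-- `Δ(1727a1) = -1727 < 0`. [cite: CremonaAlgorithms1997, Table 1] -/
theorem Δ_neg_1727a1 : c1727a1.Δ < 0 := by
  rw [baseChange_int_Δ, M1727a1_Δ]; norm_num

/-- `Δ(1727a1) ∉ ℚ²` (it is negative) — the seed binder of cell′. [folklore] -/
theorem not_isSquare_Δ_1727a1 : ¬ IsSquare c1727a1.Δ := by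
  rintro ⟨r, hr⟩; nlinarith [mul_self_nonneg r, Δ_neg_1727a1]

/-- **`1727a1` has no CM**: `gcd(Δ, c₄) = 1` and `|Δ| > 1`, so `Δ = -1727 ∤ c₄³ = 3657³` and `j ∉ ℤ`.
[cite: SilvermanATAEC1994, Thm. II.6.1] -/
theorem not_hasCM_1727a1 : ¬ c1727a1.HasCM :=
  OrdRedAtTwo.not_hasCM_baseChange_int_of_not_dvd_c₄_pow M1727a1 (by rw [M1727a1_Δ, M1727a1_c₄]; decide)

/-! ### Seed `4087c1` -/

/-- `Δ(4087c1) = -4087 < 0`. [cite: CremonaAlgorithms1997, Table 1] -/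
theorem Δ_neg_4087c1 : c4087c1.Δ < 0 := by
  rw [baseChange_int_Δ, M4087c1_Δ]; norm_num

/-- `Δ(4087c1) ∉ ℚ²` (it is negative) — the seed binder of cell′. [folklore] -/
theorem not_isSquare_Δ_4087c1 : ¬ IsSquare c4087c1.Δ := by
  rintro ⟨r, hr⟩; nlinarith [mul_self_nonneg r, Δ_neg_4087c1]

/-- **`4087c1` has no CM**: `gcd(Δ, c₄) = 1` and `|Δ| > 1`, so `Δ = -4087 ∤ c₄³ = 217³` and `j ∉ ℤ`.
[cite: SilvermanATAEC1994, Thm. II.6.1] -/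
theorem not_hasCM_4087c1 : ¬ c4087c1.HasCM :=
  OrdRedAtTwo.not_hasCM_baseChange_int_of_not_dvd_c₄_pow M4087c1 (by rw [M4087c1_Δ, M4087c1_c₄]; decide)

/-! ### Seed `4087a1` -/

/-- `Δ(4087a1) = -306452746911967 < 0`. [cite: CremonaAlgorithms1997, Table 1] -/
theorem Δ_neg_4087a1 : c4087a1.Δ < 0 := by
  rw [baseChange_int_Δ, M4087a1_Δ]; norm_num

/-- `Δ(4087a1) ∉ ℚ²` (it is negative) — the seed binder of cell′. [folklore] -/
theorem not_isSquare_Δ_4087a1 : ¬ IsSquare c4087a1.Δ := by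
  rintro ⟨r, hr⟩; nlinarith [mul_self_nonneg r, Δ_neg_4087a1]

/-- **`4087a1` has no CM**: `gcd(Δ, c₄) = 1` and `|Δ| > 1`, so `Δ = -306452746911967 ∤ c₄³ = 1799857³` and `j ∉ ℤ`.
[cite: SilvermanATAEC1994, Thm. II.6.1] -/
theorem not_hasCM_4087a1 : ¬ c4087a1.HasCM :=
  OrdRedAtTwo.not_hasCM_baseChange_int_of_not_dvd_c₄_pow M4087a1 (by rw [M4087a1_Δ, M4087a1_c₄]; decide)

/-! ### Seed `7831a1` -/

/-- `Δ(7831a1) = -13163911 < 0`. [cite: CremonaAlgorithms1997, Table 1] -/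
theorem Δ_neg_7831a1 : c7831a1.Δ < 0 := by
  rw [baseChange_int_Δ, M7831a1_Δ]; norm_num

/-- `Δ(7831a1) ∉ ℚ²` (it is negative) — the seed binder of cell′. [folklore] -/
theorem not_isSquare_Δ_7831a1 : ¬ IsSquare c7831a1.Δ := by
  rintro ⟨r, hr⟩; nlinarith [mul_self_nonneg r, Δ_neg_7831a1]

/-- **`7831a1` has no CM**: `gcd(Δ, c₄) = 1` and `|Δ| > 1`, so `Δ = -13163911 ∤ c₄³ = 19801³` and `j ∉ ℤ`.
[cite: SilvermanATAEC1994, Thm. II.6.1] -/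
theorem not_hasCM_7831a1 : ¬ c7831a1.HasCM :=
  OrdRedAtTwo.not_hasCM_baseChange_int_of_not_dvd_c₄_pow M7831a1 (by rw [M7831a1_Δ, M7831a1_c₄]; decide)

/-! ### Seed `9557a1` -/

/-- `Δ(9557a1) = -181583 < 0`. [cite: CremonaAlgorithms1997, Table 1] -/
theorem Δ_neg_9557a1 : c9557a1.Δ < 0 := by
  rw [baseChange_int_Δ, M9557a1_Δ]; norm_num

/-- `Δ(9557a1) ∉ ℚ²` (it is negative) — the seed binder of cell′. [folklore] -/
theorem not_isSquare_Δ_9557a1 : ¬ IsSquare c9557a1.Δ := by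
  rintro ⟨r, hr⟩; nlinarith [mul_self_nonneg r, Δ_neg_9557a1]

/-- **`9557a1` has no CM**: `gcd(Δ, c₄) = 1` and `|Δ| > 1`, so `Δ = -181583 ∤ c₄³ = 273³` and `j ∉ ℤ`.
[cite: SilvermanATAEC1994, Thm. II.6.1] -/
theorem not_hasCM_9557a1 : ¬ c9557a1.HasCM :=
  OrdRedAtTwo.not_hasCM_baseChange_int_of_not_dvd_c₄_pow M9557a1 (by rw [M9557a1_Δ, M9557a1_c₄]; decide)

/-! ### Seed `12261b1` -/

/-- `Δ(12261b1) = -99777896847 < 0`. [cite: CremonaAlgorithms1997, Table 1] -/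
theorem Δ_neg_12261b1 : c12261b1.Δ < 0 := by
  rw [baseChange_int_Δ, M12261b1_Δ]; norm_num

/-- `Δ(12261b1) ∉ ℚ²` (it is negative) — the seed binder of cell′. [folklore] -/
theorem not_isSquare_Δ_12261b1 : ¬ IsSquare c12261b1.Δ := by
  rintro ⟨r, hr⟩; nlinarith [mul_self_nonneg r, Δ_neg_12261b1]

/-- **`12261b1` has no CM**: `gcd(Δ, c₄) = 1` and `|Δ| > 1`, so `Δ = -99777896847 ∤ c₄³ = 20665³` and `j ∉ ℤ`.
[cite: SilvermanATAEC1994, Thm. II.6.1] -/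
theorem not_hasCM_12261b1 : ¬ c12261b1.HasCM :=
  OrdRedAtTwo.not_hasCM_baseChange_int_of_not_dvd_c₄_pow M12261b1 (by rw [M12261b1_Δ, M12261b1_c₄]; decide)

/-! ### Seed `19653d1` -/

/-- `Δ(19653d1) = -3481469991 < 0`. [cite: CremonaAlgorithms1997, Table 1] -/
theorem Δ_neg_19653d1 : c19653d1.Δ < 0 := by
  rw [baseChange_int_Δ, M19653d1_Δ]; norm_num

/-- `Δ(19653d1) ∉ ℚ²` (it is negative) — the seed binder of cell′. [folklore] -/
theorem not_isSquare_Δ_19653d1 : ¬ IsSquare c19653d1.Δ := by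
  rintro ⟨r, hr⟩; nlinarith [mul_self_nonneg r, Δ_neg_19653d1]

/-- **`19653d1` has no CM**: `gcd(Δ, c₄) = 1` and `|Δ| > 1`, so `Δ = -3481469991 ∤ c₄³ = -7943³` and `j ∉ ℤ`.
[cite: SilvermanATAEC1994, Thm. II.6.1] -/
theorem not_hasCM_19653d1 : ¬ c19653d1.HasCM :=
  OrdRedAtTwo.not_hasCM_baseChange_int_of_not_dvd_c₄_pow M19653d1 (by rw [M19653d1_Δ, M19653d1_c₄]; decide)

/-! ### Seed `25861b1` -/

/-- `Δ(25861b1) = -503957729231 < 0`. [cite: CremonaAlgorithms1997, Table 1] -/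
theorem Δ_neg_25861b1 : c25861b1.Δ < 0 := by
  rw [baseChange_int_Δ, M25861b1_Δ]; norm_num

/-- `Δ(25861b1) ∉ ℚ²` (it is negative) — the seed binder of cell′. [folklore] -/
theorem not_isSquare_Δ_25861b1 : ¬ IsSquare c25861b1.Δ := by
  rintro ⟨r, hr⟩; nlinarith [mul_self_nonneg r, Δ_neg_25861b1]

/-- **`25861b1` has no CM**: `gcd(Δ, c₄) = 1` and `|Δ| > 1`, so `Δ = -503957729231 ∤ c₄³ = 77881³` and `j ∉ ℤ`.
[cite: SilvermanATAEC1994, Thm. II.6.1] -/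
theorem not_hasCM_25861b1 : ¬ c25861b1.HasCM :=
  OrdRedAtTwo.not_hasCM_baseChange_int_of_not_dvd_c₄_pow M25861b1 (by rw [M25861b1_Δ, M25861b1_c₄]; decide)

/-! ### Seed `25861e1` -/

/-- `Δ(25861e1) = -284471 < 0`. [cite: CremonaAlgorithms1997, Table 1] -/
theorem Δ_neg_25861e1 : c25861e1.Δ < 0 := by
  rw [baseChange_int_Δ, M25861e1_Δ]; norm_num

/-- `Δ(25861e1) ∉ ℚ²` (it is negative) — the seed binder of cell′. [folklore] -/
theorem not_isSquare_Δ_25861e1 : ¬ IsSquare c25861e1.Δ := by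
  rintro ⟨r, hr⟩; nlinarith [mul_self_nonneg r, Δ_neg_25861e1]

/-- **`25861e1` has no CM**: `gcd(Δ, c₄) = 1` and `|Δ| > 1`, so `Δ = -284471 ∤ c₄³ = 1497³` and `j ∉ ℤ`.
[cite: SilvermanATAEC1994, Thm. II.6.1] -/
theorem not_hasCM_25861e1 : ¬ c25861e1.HasCM :=
  OrdRedAtTwo.not_hasCM_baseChange_int_of_not_dvd_c₄_pow M25861e1 (by rw [M25861e1_Δ, M25861e1_c₄]; decide)

/-! ### Seed `8035a1` -/

/-- `Δ(8035a1) = -25109375 < 0`. [cite: CremonaAlgorithms1997, Table 1] -/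
theorem Δ_neg_8035a1 : c8035a1.Δ < 0 := by
  rw [baseChange_int_Δ, M8035a1_Δ]; norm_num

/-- `Δ(8035a1) ∉ ℚ²` (it is negative) — the seed binder of cell′. [folklore] -/
theorem not_isSquare_Δ_8035a1 : ¬ IsSquare c8035a1.Δ := by
  rintro ⟨r, hr⟩; nlinarith [mul_self_nonneg r, Δ_neg_8035a1]

/-- **`8035a1` has no CM**: `gcd(Δ, c₄) = 1` and `|Δ| > 1`, so `Δ = -25109375 ∤ c₄³ = 7321³` and `j ∉ ℤ`.
[cite: SilvermanATAEC1994, Thm. II.6.1] -/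
theorem not_hasCM_8035a1 : ¬ c8035a1.HasCM :=
  OrdRedAtTwo.not_hasCM_baseChange_int_of_not_dvd_c₄_pow M8035a1 (by rw [M8035a1_Δ, M8035a1_c₄]; decide)

/-! ### Seed `24213c1` -/

/-- `Δ(24213c1) = -4401485711788695287076711 < 0`. [cite: CremonaAlgorithms1997, Table 1] -/
theorem Δ_neg_24213c1 : c24213c1.Δ < 0 := by
  rw [baseChange_int_Δ, M24213c1_Δ]; norm_num

/-- `Δ(24213c1) ∉ ℚ²` (it is negative) — the seed binder of cell′. [folklore] -/
theorem not_isSquare_Δ_24213c1 : ¬ IsSquare c24213c1.Δ := by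
  rintro ⟨r, hr⟩; nlinarith [mul_self_nonneg r, Δ_neg_24213c1]

/-- **`24213c1` has no CM**: `gcd(Δ, c₄) = 1` and `|Δ| > 1`, so `Δ = -4401485711788695287076711 ∤ c₄³ = 11781368881³` and `j ∉ ℤ`.
[cite: SilvermanATAEC1994, Thm. II.6.1] -/
theorem not_hasCM_24213c1 : ¬ c24213c1.HasCM :=
  OrdRedAtTwo.not_hasCM_baseChange_int_of_not_dvd_c₄_pow M24213c1 (by rw [M24213c1_Δ, M24213c1_c₄]; decide)

end Summit.BirchSwinnertonDyer.BirchSwinnertonDyer.Theorems.AlignedTransportAtTwoAlignedPairs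

end
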